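import Summits.CriticalPhenomena.PercolationContinuityZ3.Theorems.PercNearOneGluingNoHeavyQuantConvAtoms
import HarnessLib

/-!
# QUANT lane R8, T-DEC: THE EXPLICIT TWO-SEGMENT ATOM (`atomLaw`) and the explicit residue statement `ConvClosedTAtoms`
# (census-2 g58: the residue (II) of `ConvClosedT` is atom ⊗ atom with CLOSED-FORM masses — statement file of the chain
# `…QuantWindowExtremeLaw` → `…QuantWindowExtremeShape` → `…QuantConvAtomsReduction`, which proves `ConvClosedT ⟸ ConvClosedTAtoms`)

builds on p205010 (kernel theorem, internal audit signed; external expert review pending)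

Statement + support file (`--supports stmt-CriticalPhenomena-4575`), QUANT lane seat prim-quant-census-2 (gen 58), rung R8 of
`run/shared/lean/prim/quant/LADDER.md`.  Definitions `LawDec.atomLaw` (an explicit law), `LawDec.AtomData`, `LawDec.ExtremeShape` (predicates),
one `@[conjecture]` definition `LawDec.ConvClosedTAtoms`, elementary lemmas with standard axioms, no sorries.

THE POINT (memo `run/shared/lean/prim/quant/prim-quant-census-2-g58/EXTREME-ATOMS-G58.md`).  Census-2 g57 proved that every extreme point of the
window polytope is SMALL (`windowExtremeSmall_holds`) by showing that a two-sided move built from ≤ 2 elementary pieces of the top corner run is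
PROPORTIONAL to the law.  Reading that proportionality literally gives the full STRUCTURE of the extreme points (file `…QuantWindowExtremeShape`,
`windowExtreme_shape`): an extreme point either charges AT MOST ONE low of the top layer, or it IS the law `atomLaw x T j l₁ h₁ l₂ h₂` below — two
credit-tight corner segments, an EXPENSIVE one `(l₁, h₁)` (rate `c₁ = usage x T j l₁ h₁ > u = x/(1−x)`) and a CHEAP one `(l₂, h₂)` (`c₂ < u`), from
distinct lows to mids `≤ j`, with low masses in the ratio `(u − c₂) : (c₁ − u)` — which is census-2 g56's atlas closed form (Type I `h₁ = h₂`: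
`(c₁ − u)ν_{l₁} = (u − c₂)ν_{l₂}`, `ν_h = u(ν_{l₁} + ν_{l₂})`; Type II `h₁ ≠ h₂`) with the all-giant balance built in (absorber mass exactly `x`).
Since a window-DEC factor with at most one low convolves to a DEC law with ANY window-DEC factor (census-1 g20's `lconv_decAtT_of_window_singleLow`),
`ConvClosedT` reduces (Krein–Milman, bilinearity, the one-sided theorem) to the statement `ConvClosedTAtoms` below: conv DEC for
`atomLaw ⊗ atomLaw` with admissible data, both window-DEC, neither with a datum free of light straddlers — an explicit finite-parameter family
(rational masses in `x`, the targets and the positions), the object decided by census-1's LS-CORE cells and the lead's / arm-2's piece lemmas.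
`convClosedTAtoms_of_residue` (reduction file) shows it is implied by the previous statement of record `ConvClosedTResidue`.

* `LawDec.atomLaw x T j l₁ h₁ l₂ h₂ : ℕ → ℝ` — `b ↦ (1−x)/(c₁−c₂)·((u−c₂)(𝟙[b=l₁] + c₁𝟙[b=h₁]) + (c₁−u)(𝟙[b=l₂] + c₂𝟙[b=h₂]))`.
* `LawDec.AtomData x T j M l₁ h₁ l₂ h₂` — admissibility (lows of layer `j`, compatible mids `≤ j`, `≤ M`, distinct lows, `c₂ < u < c₁`).
* `LawDec.ExtremeShape x T j M μ` — at most one low of layer `j`, or `μ = atomLaw` of admissible data.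
* `LawDec.ConvClosedTAtoms` (`@[conjecture]`) — the explicit residue.
* lemmas `atomLaw_mul`, `atomLaw_eq_zero(_of_gt)`, `sum_range_atomLaw` (mass one), `atomLaw_nonneg`, `AtomData.lt_of`.

[this work]; nothing here is cited as a published result.  The gluing rows served [cite: KozmaNitzan2024, Conjecture 3 (p. 15)]; product
measure [cite: Grimmett1999, §1.3 p. 10].
-/

noncomputable section

namespace Summit.CriticalPhenomena.PercolationContinuityZ3.Theorems

namespace Quant

open Finset

namespace LawDec

/-- indicator of equality of naturals, as a real number -/
local notation3 "𝟙[" a ", " b "]" => (if (a : ℕ) = (b : ℕ) then (1 : ℝ) else 0)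

/-! ### The explicit two-segment atom and the explicit residue statement -/

/-- **THE BALANCED TWO-SEGMENT ATOM** at floor `x`, target `T`, layer `j`: the law carried by an EXPENSIVE credit-tight segment
`(l₁, h₁)` (rate `c₁ = usage x T j l₁ h₁ > x/(1−x)`) and a CHEAP one `(l₂, h₂)` (rate `c₂ < x/(1−x)`), with low masses in the ratio
`(x/(1−x) − c₂) : (c₁ − x/(1−x))` (the all-giant balance: absorber mass `= x/(1−x)·`low mass, i.e. absorbers carry exactly `x`):
`b ↦ (1−x)/(c₁−c₂) · ((u − c₂)(𝟙[b=l₁] + c₁𝟙[b=h₁]) + (c₁ − u)(𝟙[b=l₂] + c₂𝟙[b=h₂]))`, `u = x/(1−x)`.  Type I atoms of census-2 g56's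
atlas are `h₁ = h₂`, Type II `h₁ ≠ h₂`. [this work] -/
def atomLaw (x T : ℝ) (j l₁ h₁ l₂ h₂ : ℕ) : ℕ → ℝ := fun b =>
  (1 - x) / (usage x T j l₁ h₁ - usage x T j l₂ h₂) *
    ((x / (1 - x) - usage x T j l₂ h₂) * (𝟙[b, l₁] + usage x T j l₁ h₁ * 𝟙[b, h₁])
      + (usage x T j l₁ h₁ - x / (1 - x)) * (𝟙[b, l₂] + usage x T j l₂ h₂ * 𝟙[b, h₂]))

/-- **ADMISSIBLE ATOM DATA** at `(x, T, j, M)`: both segments go from a low of layer `j` (`l ≤ j`, `2l < T`) to a compatible mid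
(`h ≤ j`, `h ≤ M`, `T < l + h`), the lows are distinct, and the rates straddle the giant rate: `c₂ < x/(1−x) < c₁`. [this work] -/
def AtomData (x T : ℝ) (j M l₁ h₁ l₂ h₂ : ℕ) : Prop :=
  l₁ ≤ j ∧ 2 * (l₁ : ℝ) < T ∧ h₁ ≤ j ∧ h₁ ≤ M ∧ T < (l₁ : ℝ) + h₁ ∧
  l₂ ≤ j ∧ 2 * (l₂ : ℝ) < T ∧ h₂ ≤ j ∧ h₂ ≤ M ∧ T < (l₂ : ℝ) + h₂ ∧ l₁ ≠ l₂ ∧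
  usage x T j l₂ h₂ < x / (1 - x) ∧ x / (1 - x) < usage x T j l₁ h₁

/-- **THE STRUCTURAL ALTERNATIVE**: the law `μ` has AT MOST ONE low atom of layer `j` (some `q ≤ j` with `k ≤ j ∧ 2k < T ∧ μ k ≠ 0 ⟹ k = q`),
OR it is a balanced two-segment atom with admissible data. [this work] -/
def ExtremeShape (x T : ℝ) (j M : ℕ) (μ : ℕ → ℝ) : Prop :=
  (∃ q, q ≤ j ∧ ∀ k, k ≤ j → 2 * (k : ℝ) < T → μ k ≠ 0 → k = q) ∨
  (∃ l₁ h₁ l₂ h₂, AtomData x T j M l₁ h₁ l₂ h₂ ∧ ∀ b, μ b = atomLaw x T j l₁ h₁ l₂ h₂ b)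

/-- **CONJECTURE `ConvClosedT` FOR ATOM ⊗ ATOM (census-2 g58)** — the explicit residue of `ConvClosedT`: for a floor `0 < x < 1`, targets
`T₁, T₂`, tops `M₁, M₂`, a layer `j < M₁ + M₂`, and admissible atom data on both sides, if both atoms are DEC at every layer of their windows
(`[j − M₂, j]`, `[j − M₁, j]`) and NEITHER has a datum without light straddlers (`¬ BDECAtT`, all other pairs being settled by the one-sided
theorem), then the convolution is DEC at `(T₁ + T₂, j)`.  With `convClosedT_of_atomPairs` (file `…QuantConvAtomsReduction`) it implies `ConvClosedT`,
hence (with `GatedConvEmptyFree`) `FarTreeRow`.  EVIDENCE: census-2 g56 / census-1 g21 / lead g26 exact censuses of the residue (atom ⊗ atom,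
0 failures in > 10⁵ pairs incl. kit j149400, j154424, j155785; 13 + 25 exactly tight pairs — no uniform slack). [this work] [status: open] -/
@[conjecture] def ConvClosedTAtoms : Prop :=
  ∀ (x T₁ T₂ : ℝ) (M₁ M₂ j : ℕ) (l₁ h₁ l₁' h₁' l₂ h₂ l₂' h₂' : ℕ),
    0 < x → x < 1 → j < M₁ + M₂ →
    AtomData x T₁ j M₁ l₁ h₁ l₁' h₁' → AtomData x T₂ j M₂ l₂ h₂ l₂' h₂' →
    (∀ j'', j'' ≤ j → j ≤ j'' + M₂ → DECAtT x T₁ j'' M₁ (atomLaw x T₁ j l₁ h₁ l₁' h₁')) →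
    (∀ j'', j'' ≤ j → j ≤ j'' + M₁ → DECAtT x T₂ j'' M₂ (atomLaw x T₂ j l₂ h₂ l₂' h₂')) →
    ¬ BDECAtT x T₁ j M₁ M₂ (atomLaw x T₁ j l₁ h₁ l₁' h₁') → ¬ BDECAtT x T₂ j M₂ M₁ (atomLaw x T₂ j l₂ h₂ l₂' h₂') →
    DECAtT x (T₁ + T₂) j (M₁ + M₂) (lconv M₁ M₂ (atomLaw x T₁ j l₁ h₁ l₁' h₁') (atomLaw x T₂ j l₂ h₂ l₂' h₂'))

/-! ### Elementary facts on `atomLaw` -/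

section AtomFacts

variable (x T : ℝ) (j l₁ h₁ l₂ h₂ : ℕ)

/-- the un-normalised form. [this work] -/
theorem atomLaw_mul (hx1 : x < 1) (hc : usage x T j l₁ h₁ ≠ usage x T j l₂ h₂) (b : ℕ) :
    atomLaw x T j l₁ h₁ l₂ h₂ b * ((usage x T j l₁ h₁ - usage x T j l₂ h₂) / (1 - x))
      = (x / (1 - x) - usage x T j l₂ h₂) * (𝟙[b, l₁] + usage x T j l₁ h₁ * 𝟙[b, h₁])
        + (usage x T j l₁ h₁ - x / (1 - x)) * (𝟙[b, l₂] + usage x T j l₂ h₂ * 𝟙[b, h₂]) := by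
  have h1x : (1 : ℝ) - x ≠ 0 := by linarith
  have hcc : usage x T j l₁ h₁ - usage x T j l₂ h₂ ≠ 0 := sub_ne_zero.2 hc
  unfold atomLaw
  field_simp

/-- off the four named positions the atom carries no mass. [this work] -/
theorem atomLaw_eq_zero {b : ℕ} (hb1 : b ≠ l₁) (hb2 : b ≠ h₁) (hb3 : b ≠ l₂) (hb4 : b ≠ h₂) :
    atomLaw x T j l₁ h₁ l₂ h₂ b = 0 := by
  unfold atomLaw
  rw [if_neg hb1, if_neg hb2, if_neg hb3, if_neg hb4]
  ring

/-- the atom is supported below the larger absorber / low. [this work] -/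
theorem atomLaw_eq_zero_of_gt {M b : ℕ} (h1 : l₁ ≤ M) (h2 : h₁ ≤ M) (h3 : l₂ ≤ M) (h4 : h₂ ≤ M) (hb : M < b) :
    atomLaw x T j l₁ h₁ l₂ h₂ b = 0 :=
  atomLaw_eq_zero x T j l₁ h₁ l₂ h₂ (by omega) (by omega) (by omega) (by omega)

/-- **total mass one.** [this work] -/
theorem sum_range_atomLaw {M : ℕ} (hx1 : x < 1) (hc : usage x T j l₁ h₁ ≠ usage x T j l₂ h₂)
    (h1 : l₁ ≤ M) (h2 : h₁ ≤ M) (h3 : l₂ ≤ M) (h4 : h₂ ≤ M) :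
    ∑ b ∈ Finset.range (M + 1), atomLaw x T j l₁ h₁ l₂ h₂ b = 1 := by
  have h1x : (0 : ℝ) < 1 - x := by linarith
  have hcc : usage x T j l₁ h₁ - usage x T j l₂ h₂ ≠ 0 := sub_ne_zero.2 hc
  have hK : ((usage x T j l₁ h₁ - usage x T j l₂ h₂) / (1 - x)) ≠ 0 := div_ne_zero hcc (ne_of_gt h1x)
  -- multiply by the normalising constant
  have key : (∑ b ∈ Finset.range (M + 1), atomLaw x T j l₁ h₁ l₂ h₂ b) * ((usage x T j l₁ h₁ - usage x T j l₂ h₂) / (1 - x))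
      = (usage x T j l₁ h₁ - usage x T j l₂ h₂) / (1 - x) := by
    rw [Finset.sum_mul]
    simp_rw [atomLaw_mul x T j l₁ h₁ l₂ h₂ hx1 hc]
    rw [Finset.sum_add_distrib, ← Finset.mul_sum, ← Finset.mul_sum, Finset.sum_add_distrib, Finset.sum_add_distrib,
      ← Finset.mul_sum, ← Finset.mul_sum]
    have e : ∀ p : ℕ, p ≤ M → ∑ b ∈ Finset.range (M + 1), 𝟙[b, p] = 1 := fun p hp => by
      rw [Finset.sum_ite_eq' (Finset.range (M + 1)) p (fun _ => (1 : ℝ)), if_pos (Finset.mem_range.2 (Nat.lt_succ_of_le hp))]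
    rw [e l₁ h1, e h₁ h2, e l₂ h3, e h₂ h4]
    field_simp
    ring
  exact mul_right_cancel₀ hK (by rw [key, one_mul])

/-- **nonnegativity** for admissible rates `0 ≤ c₂ < x/(1−x) < c₁`. [this work] -/
theorem atomLaw_nonneg (hx1 : x < 1) (hc₂ : 0 ≤ usage x T j l₂ h₂) (hlt₂ : usage x T j l₂ h₂ < x / (1 - x))
    (hlt₁ : x / (1 - x) < usage x T j l₁ h₁) (b : ℕ) : 0 ≤ atomLaw x T j l₁ h₁ l₂ h₂ b := by
  have h1x : (0 : ℝ) < 1 - x := by linarith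
  have hc₁ : 0 ≤ usage x T j l₁ h₁ := by linarith
  unfold atomLaw
  refine mul_nonneg (div_nonneg h1x.le (by linarith)) (add_nonneg ?_ ?_)
  · refine mul_nonneg (by linarith) (add_nonneg ?_ (mul_nonneg hc₁ ?_)) <;> split_ifs <;> norm_num
  · refine mul_nonneg (by linarith) (add_nonneg ?_ (mul_nonneg hc₂ ?_)) <;> split_ifs <;> norm_num

end AtomFacts


/-- in admissible data the lows lie below their mids. -/
theorem AtomData.lt_of {x T : ℝ} {j M l₁ h₁ l₂ h₂ : ℕ} (hd : AtomData x T j M l₁ h₁ l₂ h₂) : l₁ < h₁ ∧ l₂ < h₂ := by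
  obtain ⟨-, a2, -, -, a5, -, b2, -, -, b5, -⟩ := hd
  constructor
  · by_contra hge; push Not at hge
    have : (h₁ : ℝ) ≤ l₁ := by exact_mod_cast hge
    linarith
  · by_contra hge; push Not at hge
    have : (h₂ : ℝ) ≤ l₂ := by exact_mod_cast hge
    linarith



end LawDec

end Quant

end Summit.CriticalPhenomena.PercolationContinuityZ3.Theorems
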